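import Summits.QuantumFields.BalabanUV.T4Continuum.Support.BalabanAveragedTowerModes

/-!
# T⁴ programme, spine node NE2 (U1a) — THE SEMIGROUP PROPERTY of Bałaban's averaging: the composite of `k` one-step
# (1.11)-averagings IS the single `L^k`-step averaging (1.18), ENTRYWISE
# (`Atow QBlev k` of `Support/BalabanAveragedTowerUnit` = «(Q_kA)_b = Σ_{x∈B^k(b₋)} η^{d+1}A([x, x(b)])», `η = L^{−k}`)

Eighth generation of the NE2 prover lineage P1 of the cell `pub-balaban`, file 5.  [Balaban1984PropagatorsI] p. 20: «It is
easily seen that a composition of k transformations is given by … (1.17) where (Q_kA)_b = Σ_{x∈B^k(b₋)} η^{d+1}A([x, x(b)]),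
b ⊂ T₁^{(k)} = ℤ^d ∩ T_η, η = L^{−k}, (1.18)».  Files 2–4 of this generation built the tower of the cell's U = 1 estimates on
the COMPOSITE `Atow QBlev k` of one-step averagings `QB n_j L` (each = (1.11) with `L`-blocks, `QB_apply`); this file certifies
the quoted «easily seen» sentence for that composite, in the kernel, as an ENTRYWISE identity:

  **`Atow_QBlev_apply`**: `(Atow QBlev k)_{(x₀,μ),(y,ν)} = δ_{μν} · n_k^{−(d+1)} · #{t < n_k : y − t e_μ ∈ B^{n_k}(x₀)}`,

`n_k = L^k`, `B^{n}(x₀) = {y : ⌊y_λ/n⌋ = (x₀)_λ ∀λ}` the `n`-block of the unit-lattice site `x₀` (block index passed as the integer tuple `(x₀)_λ.val`) — i.e. the weight of the fine bond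
`(y, μ)` in `(Q_kA)_{(x₀,μ)}` is `η^{d+1}` times the number of straight contours `[x, x + e_μ]`, `x ∈ B^k(x₀)`, passing through it,
which is (1.18) read bond by bond.  (The unit lattice here is `Tor (fine 1 M)`; `B5Block118.QvOp (L^k) M` is the same operator
on the index type `Tor M` — the types `ZMod (1·M_ν)` and `ZMod (M_ν)` are not definitionally equal, whence the entrywise form, as
for King's `Q` in `B5G183RateUnitTower.Qtow_apply`.)

 * §1 two-level bookkeeping (`N ← L·N`): `cpt` is additive and maps `s·e_μ` to `(L s)·e_μ`; `par (w − L·v) = par w − v`;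
   block membership transfers across one level (`inBlock_mul_iff`: `w ∈ B^{L n}(x₀) ↔ par w ∈ B^{n}(x₀)`, `⌊⌊w/L⌋/n⌋ =
   ⌊w/(Ln)⌋`); the double sum over (coarse site, offset) against the indicator of `y = L z + j` has exactly one term
   (`sum_sum_ite_eq_cpt_add_off`).
 * §2 the induction: base `Atow 0 = 1`; step = base-`L` digit decomposition `T = t′ + L·s` of the contour parameter
   (`finProdFinEquiv`), one-step entries from `BalabanLineAverage.QB_apply`.

HONEST FRAMING (T4-DAG p. 1).  Pure combinatorics of block/contour averaging on a finite torus at `U = 1`; identifies the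
cell's tower object with the printed (1.18); no estimate, no conditional; NOT `U ≠ 1`, NOT infinite volume, NOT a mass gap,
NOT Clay, NOT summit progress.  HONEST DEPENDENCY: continuum YM on T⁴ ⇐ BetaPertH ∧ nine spine estimates (0/9 proved);
BetaPertH ⇐ (D1) ∧ (D4) ∧ CAP+tail; G-an2-4 gates asym, D1 and NE2/3/4.  ABSOLUTE RULE kept; no `sorry`.
-/

noncomputable section

open scoped BigOperators ComplexConjugate Matrix
open Finset

namespace Summit.QuantumFields.BalabanUV.T4Continuum.BalabanAveragedTowerApply

open Literature.MathematicalPhysics.QuantumFieldTheory.Balaban1983to89.B5Prop11Plancherel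
open Literature.MathematicalPhysics.QuantumFieldTheory.Balaban1983to89.B5Block118 (tstep tstep_zero tstep_succ)
open Literature.MathematicalPhysics.QuantumFieldTheory.Balaban1983to89.B5G183RateTorus (cpt)
open Literature.MathematicalPhysics.QuantumFieldTheory.Balaban1983to89.B5G183RateTorusW (off)
open Literature.MathematicalPhysics.QuantumFieldTheory.Balaban1983to89.B5G183RateUnitTower (lev lev_neZero)
open Summit.QuantumFields.BalabanUV.T4Continuum.CovariantAveragingTower
open Summit.QuantumFields.BalabanUV.T4Continuum.BalabanLineAverage
open Summit.QuantumFields.BalabanUV.T4Continuum.BalabanAveragedTowerUnit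
open Summit.QuantumFields.BalabanUV.T4Continuum.BalabanAveragedTowerModes

variable {d : ℕ}

/-! ## §1 Two-level bookkeeping -/

section TwoLevel

variable (N R : ℕ) [NeZero N] [NeZero R] (M : Fin d → ℕ) [hM : ∀ μ, NeZero (M μ)]

omit hM in
/-- `tstep` is additive in the step count: `(a + b)e_μ = a e_μ + b e_μ`. [folklore] -/
theorem tstep_add (Nf : Fin d → ℕ) (μ : Fin d) (a b : ℕ) : tstep Nf μ (a + b) = tstep Nf μ a + tstep Nf μ b := by
  funext ν
  by_cases h : ν = μ
  · simp [tstep, h]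
  · simp [tstep, h]

omit [NeZero N] [NeZero R] hM in
/-- `R·(a mod NM) ≡ R·a (mod RNM)`: multiplication by `R` is well defined from `ℤ/NM` to `ℤ/RNM`. [folklore] -/
theorem natCast_mul_mod (a : ℕ) (ν : Fin d) :
    ((R * (a % fine N M ν) : ℕ) : ZMod (fine (R * N) M ν)) = ((R * a : ℕ) : ZMod (fine (R * N) M ν)) := by
  rw [ZMod.natCast_eq_natCast_iff']
  show R * (a % (N * M ν)) % (R * N * M ν) = R * a % (R * N * M ν)
  rw [show R * N * M ν = R * (N * M ν) from by ring, ← Nat.mul_mod_mul_left, Nat.mod_mod_of_dvd _ (dvd_refl _)]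

omit [NeZero R] in
/-- `cpt` («the coarse site as a fine site», multiplication by `R`) is additive. [folklore] -/
theorem cpt_add (x y : Tor (fine N M)) : cpt N R M (x + y) = cpt N R M x + cpt N R M y := by
  funext ν
  simp only [Pi.add_apply, cpt]
  rw [ZMod.val_add, natCast_mul_mod, mul_add, Nat.cast_add]

omit [NeZero R] in
/-- `cpt (x − y) = cpt x − cpt y`. [folklore] -/
theorem cpt_sub (x y : Tor (fine N M)) : cpt N R M (x - y) = cpt N R M x - cpt N R M y := by
  rw [eq_sub_iff_add_eq, ← cpt_add, sub_add_cancel]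

omit [NeZero N] [NeZero R] in
/-- `cpt` maps `s e_μ` (level `N`, `s < N`) to `(R s) e_μ` (level `R N`). [folklore] -/
theorem cpt_tstep (μ : Fin d) (s : ℕ) (hs : s < N) :
    cpt N R M (tstep (fine N M) μ s) = tstep (fine (R * N) M) μ (R * s) := by
  funext ν
  simp only [cpt, tstep]
  by_cases h : ν = μ
  · rw [if_pos h, if_pos h, ZMod.val_cast_of_lt]
    calc s < N := hs
      _ ≤ N * M ν := Nat.le_mul_of_pos_right _ (Nat.pos_of_ne_zero (NeZero.ne (M ν)))
  · rw [if_neg h, if_neg h, ZMod.val_zero, mul_zero, Nat.cast_zero]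

/-- `par (w − R·v) = par w − v`. [folklore] -/
theorem par_sub_cpt (w : Tor (fine (R * N) M)) (v : Tor (fine N M)) :
    par N R M (w - cpt N R M v) = par N R M w - v := by
  have e : w - cpt N R M v = cpt N R M (par N R M w - v) + off N R M (rem N R M w) := by
    rw [cpt_sub, sub_add_eq_add_sub, cpt_par_add_off_rem]
  rw [e, par_cpt_add_off]

/-- if `x = R·z + j` then `z = par x` and `j = rem x`. [folklore] -/
theorem eq_par_rem_of_eq' {x : Tor (fine (R * N) M)} {z : Tor (fine N M)} {j : Fin d → Fin R}
    (h : x = cpt N R M z + off N R M j) : z = par N R M x ∧ j = rem N R M x := by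
  constructor
  · rw [h, par_cpt_add_off]
  · rw [h, rem_cpt_add_off]

/-- the double sum over (coarse site, offset) of `f z · [x = R z + j]` is `f (par x)` — every fine site has exactly one block
parent and offset. [cite: King1986, (2.10) p.653] [folklore] -/
theorem sum_sum_ite_eq_cpt_add_off (f : Tor (fine N M) → ℂ) (x : Tor (fine (R * N) M)) :
    ∑ z : Tor (fine N M), ∑ j : Fin d → Fin R, (if x = cpt N R M z + off N R M j then f z else 0) = f (par N R M x) := by
  rw [Finset.sum_eq_single (par N R M x)]
  · rw [Finset.sum_eq_single (rem N R M x)]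
    · rw [if_pos (cpt_par_add_off_rem N R M x).symm]
    · intro j _ hj
      rw [if_neg]
      intro h; exact hj (eq_par_rem_of_eq' N R M h).2
    · intro h; exact absurd (Finset.mem_univ _) h
  · intro z _ hz
    refine Finset.sum_eq_zero fun j _ => ?_
    rw [if_neg]
    intro h; exact hz (eq_par_rem_of_eq' N R M h).1
  · intro h; exact absurd (Finset.mem_univ _) h

/-- MEMBERSHIP IN THE `n`-BLOCK OF A UNIT-LATTICE SITE with integer coordinates `b`: `y ∈ B^{n}(b) :⟺ ⌊y_λ/n⌋ = b_λ` for all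
`λ` (the unit-lattice site `x₀` enters through `b = (x₀)·.val`; this is the block of [Balaban1984PropagatorsI] (1.6) «B(y) =
{x ∈ T₁ : y_μ ≦ x_μ < y_μ + L, μ = 1, …, d}» with `L` replaced by `n = L^k` and written in `η`-units, as used in (1.18); v1.0.1:
(1.6) is now quoted verbatim). [cite: Balaban1984PropagatorsI, (1.6) p.18, (1.18) p.20] -/
def InBlock (n : ℕ) (b : Fin d → ℕ) (y : Tor (fine n M)) : Prop := ∀ ν, (y ν).val / n = b ν

omit [NeZero N] [NeZero R] hM in
/-- block membership is decidable (a finite conjunction of equalities of naturals). [folklore] -/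
instance instDecidableInBlock (n : ℕ) (b : Fin d → ℕ) (y : Tor (fine n M)) : Decidable (InBlock M n b y) := by
  unfold InBlock; infer_instance

/-- block membership transfers across one level: `w ∈ B^{R N}(b) ↔ par w ∈ B^{N}(b)` (`⌊⌊w/R⌋/N⌋ = ⌊w/(RN)⌋`). [folklore] -/
theorem inBlock_mul_iff (b : Fin d → ℕ) (w : Tor (fine (R * N) M)) :
    InBlock M (R * N) b w ↔ InBlock M N b (par N R M w) := by
  unfold InBlock
  refine forall_congr' fun ν => ?_
  rw [val_par, Nat.div_div_eq_div_mul]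

end TwoLevel

/-! ## §2 The semigroup identity along the tower -/

section Tower

variable (L : ℕ) [NeZero L] (M : Fin d → ℕ) [hM : ∀ μ, NeZero (M μ)]

/-- the number of straight contours through a fine bond: `#{t < n : y − t e_μ ∈ B^{n}(x₀)}`, as a complex number. [cite:
Balaban1984PropagatorsI, (1.18) p.20] [folklore] -/
def lineCount (n : ℕ) (b : Fin d → ℕ) (μ : Fin d) (y : Tor (fine n M)) : ℂ :=
  ∑ t : Fin n, if InBlock M n b (y - tstep (fine n M) μ (t : ℕ)) then 1 else 0

/-- base-`L` digit decomposition of the contour count: `#{T < L n : y − T e ∈ B^{Ln}(x₀)} = Σ_{s<n} Σ_{t′<L} [par(y − t′e) −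
s e ∈ B^{n}(x₀)]` (`T = t′ + L s`, `par (y − t′e − L s e) = par(y − t′e) − s e`). [folklore] -/
theorem lineCount_mul (n : ℕ) [NeZero n] (b : Fin d → ℕ) (μ : Fin d) (y : Tor (fine (L * n) M)) :
    lineCount M (L * n) b μ y
      = ∑ s : Fin n, ∑ t' : Fin L,
          if InBlock M n b (par n L M (y - tstep (fine (L * n) M) μ (t' : ℕ)) - tstep (fine n M) μ (s : ℕ))
          then 1 else 0 := by
  unfold lineCount
  -- reindex `T : Fin (L * n)` by `(s, t') : Fin n × Fin L`, `T = t' + L * s`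
  have e1 : ∑ T : Fin (L * n), (if InBlock M (L * n) b (y - tstep (fine (L * n) M) μ (T : ℕ)) then (1 : ℂ) else 0)
      = ∑ p : Fin n × Fin L, (if InBlock M (L * n) b
          (y - tstep (fine (L * n) M) μ ((p.2 : ℕ) + L * (p.1 : ℕ))) then (1 : ℂ) else 0) := by
    refine (Fintype.sum_equiv ((finProdFinEquiv.trans (finCongr (Nat.mul_comm n L)))) _ _ fun p => ?_).symm
    have hv : (((finProdFinEquiv.trans (finCongr (Nat.mul_comm n L))) p : Fin (L * n)) : ℕ) = (p.2 : ℕ) + L * (p.1 : ℕ) := by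
      simp [finProdFinEquiv]
    rw [hv]
  rw [e1, Fintype.sum_prod_type]
  refine Finset.sum_congr rfl fun s _ => Finset.sum_congr rfl fun t' _ => ?_
  have hs : (s : ℕ) < n := s.isLt
  have e2 : y - tstep (fine (L * n) M) μ ((t' : ℕ) + L * (s : ℕ))
      = (y - tstep (fine (L * n) M) μ (t' : ℕ)) - cpt n L M (tstep (fine n M) μ (s : ℕ)) := by
    rw [tstep_add, cpt_tstep n L M μ s hs, sub_sub]
  simp_rw [e2, inBlock_mul_iff, par_sub_cpt]

/-- base of the induction, at the syntactic level `1`: `(1)_{(x₀,μ),(y,ν)} = δ_{μν}·1·#{t < 1 : y − t e_μ ∈ B^1(x₀)}`.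
[folklore] -/
theorem one_apply_eq_lineCount (i y : Tor (fine 1 M) × Fin d) :
    (1 : Matrix (Tor (fine 1 M) × Fin d) (Tor (fine 1 M) × Fin d) ℂ) i y
      = if i.2 = y.2 then ((((1 : ℕ) : ℂ)) ^ (d + 1))⁻¹ * lineCount M 1 (fun ν => (i.1 ν).val) i.2 y.1 else 0 := by
  obtain ⟨y₁, ν⟩ := y
  obtain ⟨x₀, μ⟩ := i
  rw [Matrix.one_apply]
  simp only [lineCount, Fin.sum_univ_one, Fin.val_zero, tstep_zero, sub_zero, Nat.cast_one, one_pow, inv_one, one_mul]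
  have hblk : InBlock M 1 (fun ν => (x₀ ν).val) y₁ ↔ y₁ = x₀ := by
    unfold InBlock
    simp only [Nat.div_one]
    constructor
    · intro h; funext nu; exact ZMod.val_injective _ (h nu)
    · intro h nu; rw [h]
  simp_rw [hblk]
  by_cases hμ : μ = ν
  · subst hμ
    by_cases hy : y₁ = x₀
    · subst hy; simp
    · have hne : ¬ ((x₀, μ) : Tor (fine 1 M) × Fin d) = (y₁, μ) := fun h => hy (Prod.ext_iff.mp h).1.symm
      rw [if_neg hne, if_pos rfl, if_neg hy]
  · have hne : ¬ ((x₀, μ) : Tor (fine 1 M) × Fin d) = (y₁, ν) := fun h => hμ (Prod.ext_iff.mp h).2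
    rw [if_neg hne, if_neg hμ]

/-- the induction step, at the syntactic level `L · n_k`. [folklore] -/
theorem mul_QBlev_apply_of (k : ℕ) (i : idx L M 0)
    (ih : ∀ z : idx L M k, Atow (QBlev L M) k i z
      = if i.2 = z.2 then ((((lev L k : ℕ) : ℂ)) ^ (d + 1))⁻¹ * lineCount M (lev L k) (fun ν => (i.1 ν).val) i.2 z.1 else 0)
    (y : Tor (fine (L * lev L k) M) × Fin d) :
    (Atow (QBlev L M) k * QBlev L M k) i y
      = if i.2 = y.2 then ((((L * lev L k : ℕ) : ℂ)) ^ (d + 1))⁻¹ * lineCount M (L * lev L k) (fun ν => (i.1 ν).val) i.2 y.1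
        else 0 := by
  rw [Matrix.mul_apply]
  have hQB : ∀ z : idx L M k, QBlev L M k z y = ((L : ℂ) ^ (d + 1))⁻¹ *
      ∑ j : Fin d → Fin L, ∑ t : Fin L,
        (if y = (cpt (lev L k) L M z.1 + off (lev L k) L M j + tstep (fine (L * (lev L k)) M) z.2 (t : ℕ), z.2) then 1 else 0) :=
    fun z => QB_apply (lev L k) L M z y
  simp_rw [ih, hQB]
  rw [Fintype.sum_prod_type, Finset.sum_comm, Finset.sum_eq_single i.2]
  rotate_left
  · intro μ' _ hμ'
    refine Finset.sum_eq_zero fun z₁ _ => ?_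
    rw [if_neg (Ne.symm hμ'), zero_mul]
  · intro h; exact absurd (Finset.mem_univ _) h
  simp only [if_true]
  obtain ⟨y₁, ν⟩ := y
  obtain ⟨x₀, μ⟩ := i
  simp only
  by_cases hν : μ = ν
  · subst hν
    rw [if_pos rfl]
    have hpair : ∀ (z₁ : Tor (fine (lev L k) M)) (j : Fin d → Fin L) (t : Fin L),
        (((y₁, μ) : Tor (fine (L * (lev L k)) M) × Fin d) = (cpt (lev L k) L M z₁ + off (lev L k) L M j + tstep (fine (L * (lev L k)) M) μ (t : ℕ), μ))
          ↔ (y₁ - tstep (fine (L * (lev L k)) M) μ (t : ℕ) = cpt (lev L k) L M z₁ + off (lev L k) L M j) := by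
      intro z₁ j t
      rw [Prod.mk.injEq, sub_eq_iff_eq_add]
      simp
    simp_rw [hpair]
    have hre : ∀ z₁ : Tor (fine (lev L k) M),
        (((((lev L k) : ℕ) : ℂ)) ^ (d + 1))⁻¹ * lineCount M (lev L k) (fun ν => (x₀ ν).val) μ z₁ *
          (((L : ℂ) ^ (d + 1))⁻¹ * ∑ j : Fin d → Fin L, ∑ t : Fin L,
            (if y₁ - tstep (fine (L * (lev L k)) M) μ (t : ℕ) = cpt (lev L k) L M z₁ + off (lev L k) L M j then (1 : ℂ) else 0))
        = (((((lev L k) : ℕ) : ℂ)) ^ (d + 1))⁻¹ * ((L : ℂ) ^ (d + 1))⁻¹ *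
          ∑ t : Fin L, ∑ j : Fin d → Fin L,
            (if y₁ - tstep (fine (L * (lev L k)) M) μ (t : ℕ) = cpt (lev L k) L M z₁ + off (lev L k) L M j
              then lineCount M (lev L k) (fun ν => (x₀ ν).val) μ z₁ else 0) := by
      intro z₁
      rw [Finset.sum_comm, Finset.mul_sum, Finset.mul_sum, Finset.mul_sum]
      refine Finset.sum_congr rfl fun t _ => ?_
      rw [Finset.mul_sum, Finset.mul_sum, Finset.mul_sum]
      refine Finset.sum_congr rfl fun j _ => ?_
      split_ifs <;> ring
    simp_rw [hre]
    rw [← Finset.mul_sum, Finset.sum_comm]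
    simp_rw [sum_sum_ite_eq_cpt_add_off]
    rw [lineCount_mul, Finset.sum_comm]
    simp only [lineCount]
    push_cast
    rw [mul_pow, mul_inv, mul_comm ((((L : ℕ) : ℂ)) ^ (d + 1))⁻¹]
  · rw [if_neg hν]
    refine Finset.sum_eq_zero fun z₁ _ => ?_
    have h0 : ∀ (j : Fin d → Fin L) (t : Fin L),
        ¬ ((y₁, ν) : Tor (fine (L * (lev L k)) M) × Fin d) = (cpt (lev L k) L M z₁ + off (lev L k) L M j + tstep (fine (L * (lev L k)) M) μ (t : ℕ), μ) := by
      intro j t h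
      exact hν ((Prod.ext_iff.mp h).2).symm
    simp_rw [if_neg (h0 _ _)]
    simp

/-- **THE SEMIGROUP PROPERTY, ENTRYWISE**: the composite of the `k` one-step (1.11)-averagings of the tower IS the single
`L^k`-step averaging (1.18): `(Atow QBlev k)_{(x₀,μ),(y,ν)} = δ_{μν}·n_k^{−(d+1)}·#{t < n_k : y − t e_μ ∈ B^{n_k}(x₀)}` —
«(Q_kA)_b = Σ_{x∈B^k(b₋)} η^{d+1}A([x, x(b)])», `η = L^{−k}`, read bond by bond.
[cite: Balaban1984PropagatorsI, (1.17)-(1.18) p.20, (1.11) p.19] -/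
theorem Atow_QBlev_apply (k : ℕ) (i : idx L M 0) (y : idx L M k) :
    Atow (QBlev L M) k i y
      = if i.2 = y.2 then ((((lev L k : ℕ) : ℂ)) ^ (d + 1))⁻¹ * lineCount M (lev L k) (fun ν => (i.1 ν).val) i.2 y.1
        else 0 := by
  induction k with
  | zero => exact one_apply_eq_lineCount M i y
  | succ k ih => exact mul_QBlev_apply_of L M k i ih y

end Tower

end Summit.QuantumFields.BalabanUV.T4Continuum.BalabanAveragedTowerApply

end
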